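import Mathlib
import Literature.AlgebraicGeometry.Resolution.RootAdjunctionRegular
import Literature.AlgebraicGeometry.Resolution.WeightedOrderIdeals
import Literature.AlgebraicGeometry.Resolution.RegularSystemOfParameters
import HarnessLib

/-!
# Weighted quasi-regularity of a regular system of parameters

Topic: `Literature/AlgebraicGeometry/Resolution`. The completion-free core of the "standard
arguments" in the termination proof of Cossart–Piltant 2008, Prop. 4.4 (p. 11, case `τ = 2`):
for a regular local ring `(R, 𝔪, k)` of dimension `3` with regular system of parameters
`(u, y₂, y₃)` and an integer weight `d ≥ 1`, the weighted order ideals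
`F_ρ = (uᵏ y₂ᵃ y₃ᵇ : k + d(a+b) ≥ ρ)` (`WeightedOrderIdeals.lean`) satisfy **weighted
quasi-regularity**: a weighted-homogeneous form `F(U, Y₂, Y₃)` of weight `ρ` with
`F(u, y₂, y₃) ∈ F_{ρ+1}` has all its coefficients in `𝔪` (`coeff_mem_maximalIdeal_of_weval_mem`).
Proof: in the regular local ring `S = R[s, t]/(s^d − y₂, t^d − y₃)` with regular system of
parameters `(u, s, t)` (`RootAdjunctionRegular.lean`, twice) `F(u, s^d, t^d)` is an honest form of
degree `ρ` lying in `𝔫^{ρ+1}`, so Matsumura's Thm. 17.10 (`coeff_mem_maximalIdeal_of_eval_mem_pow`)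
applies, and `𝔫 ∩ R = 𝔪`.

* `exists_rootAdjunction` — the ring `S` packaged existentially;
* `mem_weightedIdeal_iff_exists_mvPolynomial` — `F_ρ = {P(u, y) : all monomials of P have weight ≥ ρ}`;
* `coeff_mem_maximalIdeal_of_weval_mem` — **weighted quasi-regularity**.

## Sources

* H. Hironaka, *Characteristic polyhedra of singularities*, J. Math. Kyoto Univ. 7 (1967). [Hironaka1967]
* H. Matsumura, *Commutative Ring Theory* (1986), Thm. 17.10. [Matsumura1987]
* V. Cossart, O. Piltant, J. Algebra 320 (2008), proof of Prop. 4.4, p. 11. [CossartPiltant2008]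
-/

noncomputable section

open IsLocalRing MvPolynomial

namespace Literature.AlgebraicGeometry.Resolution

universe u

variable {R : Type u} [CommRing R]

/-- The weight vector `(1, d, d)`. [folklore] -/
def wt (d : ℕ) : Fin 3 → ℕ := ![1, d, d]

/-- Simp lemma / component formula. [folklore] -/
@[simp] theorem wt_zero (d : ℕ) : wt d 0 = 1 := rfl
/-- Simp lemma / component formula. [folklore] -/
@[simp] theorem wt_one (d : ℕ) : wt d 1 = d := rfl
/-- Simp lemma / component formula. [folklore] -/
@[simp] theorem wt_two (d : ℕ) : wt d 2 = d := rfl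

/-- The weighted degree of an exponent `m` is `m₀ + d(m₁ + m₂)`. [folklore] -/
theorem weight_wt_eq (d : ℕ) (m : Fin 3 →₀ ℕ) :
    Finsupp.weight (wt d) m = m 0 + d * (m 1 + m 2) := by
  rw [Finsupp.weight_apply, Finsupp.sum_fintype _ _ (by simp)]
  simp [Fin.sum_univ_three, wt]
  ring

/-- The monomial `x^m = u^{m₀} y₂^{m₁} y₃^{m₂}`. [folklore] -/
theorem eval_monomial_three (x : Fin 3 → R) (m : Fin 3 →₀ ℕ) (a : R) :
    eval x (monomial m a) = a * (x 0 ^ m 0 * x 1 ^ m 1 * x 2 ^ m 2) := by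
  rw [eval_monomial, Finsupp.prod_fintype _ _ (by simp)]
  simp [Fin.prod_univ_three, mul_assoc]

/-! ## `F_ρ` via polynomials all of whose monomials have weight `≥ ρ` -/

/-- **`F_ρ = {P(u, y₂, y₃) : every monomial of `P` has weight ≥ ρ}`.** [folklore] -/
theorem mem_weightedIdeal_iff_exists_mvPolynomial (u y₂ y₃ : R) (d ρ : ℕ) (f : R) :
    f ∈ weightedIdeal u y₂ y₃ d ρ ↔ ∃ P : MvPolynomial (Fin 3) R,
      (∀ m ∈ P.support, ρ ≤ Finsupp.weight (wt d) m) ∧ eval ![u, y₂, y₃] P = f := by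
  constructor
  · intro hf
    refine Submodule.span_induction ?_ ?_ ?_ ?_ hf
    · rintro _ ⟨k, a, b, hk, rfl⟩
      refine ⟨monomial (Finsupp.equivFunOnFinite.symm ![k, a, b]) 1, ?_, ?_⟩
      · intro m hm
        classical
        have hm' := Finset.mem_singleton.mp (support_monomial_subset hm)
        subst hm'
        rw [weight_wt_eq]
        simpa using hk
      · rw [eval_monomial_three]
        simp
    · exact ⟨0, by simp, by simp⟩
    · rintro f g - - ⟨P, hP, rfl⟩ ⟨Q, hQ, rfl⟩
      refine ⟨P + Q, fun m hm => ?_, by rw [map_add]⟩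
      rcases Finset.mem_union.mp (support_add hm) with h | h
      · exact hP m h
      · exact hQ m h
    · rintro r f - ⟨P, hP, rfl⟩
      refine ⟨C r * P, fun m hm => ?_, by rw [map_mul, eval_C, smul_eq_mul]⟩
      classical
      have : m ∈ P.support := by
        rw [mem_support_iff] at hm ⊢
        rw [coeff_C_mul] at hm
        exact right_ne_zero_of_mul hm
      exact hP m this
  · rintro ⟨P, hP, rfl⟩
    rw [P.as_sum, map_sum]
    refine Ideal.sum_mem _ fun m hm => ?_
    rw [eval_monomial_three]
    refine Ideal.mul_mem_left _ _ (monomial_mem_weightedIdeal u y₂ y₃ ?_)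
    have := hP m hm
    rwa [weight_wt_eq] at this

/-! ## The ring `S = R[s, t]/(s^d − y₂, t^d − y₃)` -/

/-- **The root adjunction** `S = R[s,t]/(s^d − y₂, t^d − y₃)` of a regular local ring of
dimension `3` with regular system of parameters `(u, y₂, y₃)`: a regular local ring of dimension
`3` with regular system of parameters `(u, s, t)`, `s^d = y₂`, `t^d = y₃`, over which `R` embeds
by a local homomorphism. [cite: Hironaka1967, §1] [cite: Matsumura1987, Thm. 14.2] -/
theorem exists_rootAdjunction [IsRegularLocalRing R] (u y₂ y₃ : R)
    (hgen : Ideal.span {u, y₂, y₃} = maximalIdeal R) (hdim : ringKrullDim R = 3) {d : ℕ}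
    (hd : 0 < d) :
    ∃ (S : Type u) (_ : CommRing S) (_ : IsRegularLocalRing S) (ι : R →+* S) (s t : S),
      IsLocalHom ι ∧ Function.Injective ι ∧ s ^ d = ι y₂ ∧ t ^ d = ι y₃ ∧
      Ideal.span {ι u, s, t} = maximalIdeal S ∧ ringKrullDim S = 3 := by
  -- first adjunction: `B₁ = R[s]/(s^d − y₂)`, `𝔪_{B₁} = (s, u, y₃)`
  have hgen1 : Ideal.span (insert y₂ (Set.range ![u, y₃])) = maximalIdeal R := by
    rw [← hgen]; congr 1; ext a; simp [Matrix.range_cons, Matrix.range_empty]; tauto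
  obtain ⟨hloc1, hreg1, hdim1, hmax1, hlh1, hinj1⟩ :=
    AdjoinRoot.isRegularLocalRing_X_pow_sub_C (m := 2) ![u, y₃] y₂ hgen1 (by rw [hdim]; rfl) hd
  set B₁ := AdjoinRoot (Polynomial.X ^ d - Polynomial.C y₂ : Polynomial R)
  haveI := hloc1
  haveI := hreg1
  set ι₁ : R →+* B₁ := AdjoinRoot.of _
  set s : B₁ := AdjoinRoot.root _
  have hs : s ^ d = ι₁ y₂ := by
    have := AdjoinRoot.eval₂_root (Polynomial.X ^ d - Polynomial.C y₂ : Polynomial R)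
    rwa [Polynomial.eval₂_sub, Polynomial.eval₂_X_pow, Polynomial.eval₂_C, sub_eq_zero] at this
  -- second adjunction: `S = B₁[t]/(t^d − y₃)`, `𝔪_S = (t, u, s)`
  have hgen2 : Ideal.span (insert (ι₁ y₃) (Set.range ![ι₁ u, s])) = maximalIdeal B₁ := by
    rw [hmax1]; congr 1; ext a
    simp [Matrix.range_cons, Matrix.range_empty, s, ι₁]
    tauto
  obtain ⟨hloc2, hreg2, hdim2, hmax2, hlh2, hinj2⟩ :=
    AdjoinRoot.isRegularLocalRing_X_pow_sub_C (m := 2) ![ι₁ u, s] (ι₁ y₃) hgen2 hdim1 hd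
  set S := AdjoinRoot (Polynomial.X ^ d - Polynomial.C (ι₁ y₃) : Polynomial B₁)
  haveI := hloc2
  haveI := hreg2
  set ι₂ : B₁ →+* S := AdjoinRoot.of _
  set t : S := AdjoinRoot.root _
  have ht : t ^ d = ι₂ (ι₁ y₃) := by
    have := AdjoinRoot.eval₂_root (Polynomial.X ^ d - Polynomial.C (ι₁ y₃) : Polynomial B₁)
    rwa [Polynomial.eval₂_sub, Polynomial.eval₂_X_pow, Polynomial.eval₂_C, sub_eq_zero] at this
  haveI : IsLocalHom ι₁ := hlh1
  haveI : IsLocalHom ι₂ := hlh2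
  refine ⟨S, inferInstance, hreg2, ι₂.comp ι₁, ι₂ s, t, RingHom.isLocalHom_comp _ _,
    hinj2.comp hinj1, ?_, ?_, ?_, ?_⟩
  · rw [RingHom.comp_apply, ← hs, map_pow]
  · rw [RingHom.comp_apply, ht]
  · rw [hmax2]; congr 1; ext a
    simp [t, ι₂]
    tauto
  · exact_mod_cast hdim2

/-! ## Weighted quasi-regularity -/

section WQR

variable [IsRegularLocalRing R] (u y₂ y₃ : R) (hgen : Ideal.span {u, y₂, y₃} = maximalIdeal R)
  (hdim : ringKrullDim R = 3) {d : ℕ} (hd : 0 < d)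

/-- The exponent map `(k, a, b) ↦ (k, da, db)`. [folklore] -/
def stretch (d : ℕ) (m : Fin 3 →₀ ℕ) : Fin 3 →₀ ℕ :=
  Finsupp.equivFunOnFinite.symm ![m 0, d * m 1, d * m 2]

/-- Simp lemma / component formula. [folklore] -/
@[simp] theorem stretch_apply_zero (d : ℕ) (m : Fin 3 →₀ ℕ) : stretch d m 0 = m 0 := rfl
/-- Simp lemma / component formula. [folklore] -/
@[simp] theorem stretch_apply_one (d : ℕ) (m : Fin 3 →₀ ℕ) : stretch d m 1 = d * m 1 := rfl
/-- Simp lemma / component formula. [folklore] -/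
@[simp] theorem stretch_apply_two (d : ℕ) (m : Fin 3 →₀ ℕ) : stretch d m 2 = d * m 2 := rfl

include hd in
/-- `stretch` is injective for `d ≥ 1`. [folklore] -/
theorem stretch_injective : Function.Injective (stretch d) := by
  intro m m' h
  ext i
  fin_cases i
  · have := congrArg (fun n : Fin 3 →₀ ℕ => n 0) h
    simpa using this
  · have := congrArg (fun n : Fin 3 →₀ ℕ => n 1) h
    simp only [stretch_apply_one] at this
    exact Nat.eq_of_mul_eq_mul_left hd this
  · have := congrArg (fun n : Fin 3 →₀ ℕ => n 2) h
    simp only [stretch_apply_two] at this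
    exact Nat.eq_of_mul_eq_mul_left hd this

/-- The degree of `stretch d m` is the weight of `m`. [folklore] -/
theorem degree_stretch (d : ℕ) (m : Fin 3 →₀ ℕ) :
    (stretch d m).degree = Finsupp.weight (wt d) m := by
  rw [weight_wt_eq, Finsupp.degree_eq_weight_one]
  change Finsupp.weight (fun _ => 1) (stretch d m) = _
  rw [Finsupp.weight_apply, Finsupp.sum_fintype _ _ (by simp)]
  simp [Fin.sum_univ_three]
  ring

include hgen hdim hd in
/-- **Weighted quasi-regularity** (Hironaka; via Matsumura 17.10 in `R[s,t]/(s^d−y₂, t^d−y₃)`):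
if `F ∈ R[U, Y₂, Y₃]` is weighted-homogeneous of weight `ρ` for the weights `(1, d, d)` and
`F(u, y₂, y₃) ∈ F_{ρ+1}`, then every coefficient of `F` lies in `𝔪`.
[cite: Hironaka1967, §1] [cite: Matsumura1987, Thm. 17.10] -/
theorem coeff_mem_maximalIdeal_of_weval_mem {ρ : ℕ} {F : MvPolynomial (Fin 3) R}
    (hF : ∀ m ∈ F.support, Finsupp.weight (wt d) m = ρ)
    (h : eval ![u, y₂, y₃] F ∈ weightedIdeal u y₂ y₃ d (ρ + 1)) (m : Fin 3 →₀ ℕ) :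
    F.coeff m ∈ maximalIdeal R := by
  classical
  by_cases hm : m ∈ F.support
  swap
  · rw [notMem_support_iff.mp hm]; exact Ideal.zero_mem _
  obtain ⟨S, _, _, ι, s, t, hιloc, -, hs, ht, hgenS, hdimS⟩ :=
    exists_rootAdjunction u y₂ y₃ hgen hdim hd
  haveI := hιloc
  -- the stretched form `G(U, S, T) = Σ ι(F_m) U^{m₀} S^{d m₁} T^{d m₂}`
  set G : MvPolynomial (Fin 3) S := ∑ n ∈ F.support, monomial (stretch d n) (ι (F.coeff n))
    with hG
  have hGcoeff : ∀ n ∈ F.support, G.coeff (stretch d n) = ι (F.coeff n) := by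
    intro n hn
    rw [hG, coeff_sum, Finset.sum_eq_single n]
    · rw [coeff_monomial, if_pos rfl]
    · intro n' _ hne
      rw [coeff_monomial, if_neg]
      exact fun h' => hne (stretch_injective hd h')
    · intro hn'; exact absurd hn hn'
  have hGhom : G.IsHomogeneous ρ := by
    rw [hG]
    refine IsHomogeneous.sum _ _ _ fun n hn => ?_
    refine isHomogeneous_monomial _ ?_
    rw [degree_stretch, hF n hn]
  -- `G(u, s, t) = ι (F(u, y₂, y₃))`
  set x : Fin 3 → S := ![ι u, s, t] with hx
  have hGeval : eval x G = ι (eval ![u, y₂, y₃] F) := by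
    conv_rhs => rw [F.as_sum, map_sum, map_sum]
    rw [hG, map_sum]
    refine Finset.sum_congr rfl fun n _ => ?_
    rw [eval_monomial_three, eval_monomial_three, map_mul, map_mul, map_mul, map_pow, map_pow,
      map_pow]
    simp only [hx, stretch_apply_zero, stretch_apply_one, stretch_apply_two,
      Matrix.cons_val_zero, Matrix.cons_val_one, Matrix.cons_val_two, Matrix.tail_cons,
      Matrix.head_cons]
    rw [pow_mul, pow_mul, hs, ht, ← map_pow, ← map_pow]
  -- `ι(F_{ρ+1}) ⊆ 𝔫^{ρ+1}`
  have hFle : (weightedIdeal u y₂ y₃ d (ρ + 1)).map ι ≤ maximalIdeal S ^ (ρ + 1) := by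
    rw [weightedIdeal, Ideal.map_span]
    refine Ideal.span_le.mpr ?_
    rintro _ ⟨_, ⟨k, a, b, hk, rfl⟩, rfl⟩
    rw [map_mul, map_mul, map_pow, map_pow, map_pow, ← hs, ← ht, ← pow_mul, ← pow_mul]
    have hu : ι u ∈ maximalIdeal S := hgenS ▸ Ideal.subset_span (by simp)
    have hs' : s ∈ maximalIdeal S := hgenS ▸ Ideal.subset_span (by simp)
    have ht' : t ∈ maximalIdeal S := hgenS ▸ Ideal.subset_span (by simp)
    have := Ideal.mul_mem_mul (Ideal.mul_mem_mul (Ideal.pow_mem_pow hu k)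
      (Ideal.pow_mem_pow hs' (d * a))) (Ideal.pow_mem_pow ht' (d * b))
    rw [← pow_add, ← pow_add] at this
    refine Ideal.pow_le_pow_right ?_ this
    nlinarith
  have hGmem : eval x G ∈ maximalIdeal S ^ (ρ + 1) := by
    rw [hGeval]; exact hFle (Ideal.mem_map_of_mem _ h)
  -- Matsumura 17.10 in `S`
  have hfr : (maximalIdeal S).spanFinrank = 3 := by
    have := (isRegularLocalRing_iff S).mp inferInstance
    rw [hdimS] at this
    exact_mod_cast this
  have hxS : Ideal.span (Set.range x) = maximalIdeal S := by
    rw [← hgenS, hx]; congr 1; ext a; simp [Matrix.range_cons, Matrix.range_empty]; tauto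
  have hc := coeff_mem_maximalIdeal_of_eval_mem_pow hfr x hxS hGhom hGmem (stretch d m)
  rw [hGcoeff m hm] at hc
  -- `ι` is local: `ι(c) ∈ 𝔫 ⇒ c ∈ 𝔪`
  by_contra hcm
  have hunit : IsUnit (F.coeff m) := by
    by_contra h'; exact hcm ((IsLocalRing.mem_maximalIdeal _).mpr h')
  exact (IsLocalRing.mem_maximalIdeal _).mp hc (hunit.map ι)

end WQR

end Literature.AlgebraicGeometry.Resolution

end
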